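import Summits.QuantumFields.BalabanUV.T4Continuum.Spine.NE3.RemainderL1FinalB8
import HarnessLib

/-!
# T⁴ programme, node NE3 — census R26′, step 2d-γ: THE TWO SUMMED COARSE SIZES OF `φ = QbarIter L (j+1) W Z` FROM THE REMAINDER TOWERS,
# in the format of `SupplierB8LevelSizes`∕`PreSizesOfSizesB8` (`M^d·dirSq φ ≤ P²b²M⁴·dirSq Z F`, `M^d·dirL1 φ ≤ Q·M²·dirSq Z F`)

Cell `pub-balaban-gaps` (YM blitz, track G2, seat `ne3`, unit `pub-balaban-gaps-ne3`; writer prover-pub-balaban-gaps-ne3-g4-0, 2026-08-23), census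
`run/shared/lean/pub/pub-balaban-gaps/ne/NE3.md` §4 R26′ ∕ §10 F8.  Pure power-counting on the outputs of `RemainderTowerB8.sqrt_l2sq_QbarIter_le` (ℓ²) and
`RemainderL1FinalB8.dirL1_QbarIter_le_quadratic` (ℓ¹, quadratic): `M^d·(ρL)^{2j} = L^d·(L⁴)^j` and `M^d·(L^{2−d})^j = L^d·(L²)^j`, so the letters `P`, `Q` are k-FREE under the two
displayed lines `(32K)²·L^d ≤ P²·L⁴`, `64K₁′·L^d ≤ Q·L²` (at `d = 4`: `P ≥ 32K`, `Q ≥ 64K₁′L²`; `K = C₁L²√(d(4L+1)^d)`, `K₁′ = C₁L²·d(4L+1)^d`).  With this file the class-level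
supplier can call `SupplierB8LevelSizes.decomposedRepT_slicB8_of_landauRepB8Avg_sizes` WITHOUT the (Π-REG) majorant (step 2d-δ: the `SupplierB8SfClass`∕END re-wiring, NOT here).

CONTENT (0 sorry, 0 def): `pow_tower_l2`, `pow_tower_l1` (the two power identities), **`coarseSizes_of_towers`** [folklore].

HONEST FRAMING.  Kinematics∕bookkeeping on OUR objects under displayed k-free lines (incl. the ℓ¹ tower's level-sum line); NOTHING of Bałaban's is proved; **NE3 is NOT proved**;
spine PROVED 0∕9; finite T⁴ rung (B)+1 — NOT continuum YM on ℝ⁴, NOT infinite volume, NOT mass gap, NOT `BetaPertH`, NOT Clay.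
PLACEMENT: `Summits/QuantumFields/BalabanUV/T4Continuum/Spine/NE3/`.
-/

set_option autoImplicit false

open scoped BigOperators Matrix.Norms.L2Operator
open NormedSpace Finset

namespace Summit.QuantumFields.BalabanUV.T4Continuum.NE3.CoarseSizesFromTowersB8

open Literature.MathematicalPhysics.QuantumFieldTheory.Balaban1983to89
open B7Prop1Explicit B7Prop2Explicit B7Prop3Flat MatrixLog
open B7Eq92Concrete (dbavgCovIter)
open T4AveragingDeficitWall (IsSkewDir IsUnitaryCfg SmallField Ad dirSq dirL1)
open T4AveragingDeficitWallBoundary (IsPeriodicCfg periodBox)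
open AveragingDeficitPeriodicCounting (IsPeriodicDir)
open AveragingDeficitMultiLevelPrep (LevelSmall)
open NE3TangentCovariantTower (QbarIter)
open NE3CovariantLineSumsL2 (l2sq l2sq_nonneg)
open NE3.QbarDictionary (adField)
open NE3.RemainderTowerB8 (sqrt_l2sq_QbarIter_le)
open NE3.RemainderL1FinalB8 (dirL1_QbarIter_le_quadratic)
open ReplicationRightInverseBound (radSum)
open BlockAverageVaryHolo (nbRad)
open NE3CovariantLineSumsError (Csup)
open ShellMeasureAverageProp4General (C1cov C1cov_pos)

noncomputable section

variable {d : ℕ} {n : Type*} [Fintype n] [DecidableEq n]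

/-! ## §1 The two power identities -/

/-- `M^d·(ρL)^{2j} = L^d·(L⁴)^j` for `M = L^{j+1}`, `ρ² = L²∕L^d` (`L > 0`). [folklore] -/
theorem pow_tower_l2 {L : ℝ} (hL : 0 < L) (d j : ℕ) :
    (L ^ (j + 1)) ^ d * ((Real.sqrt (L ^ 2 / L ^ d) * L) ^ j) ^ 2 = L ^ d * (L ^ 4) ^ j := by
  have hLd : 0 < L ^ d := pow_pos hL d
  have eρ : Real.sqrt (L ^ 2 / L ^ d) ^ 2 = L ^ 2 / L ^ d := Real.sq_sqrt (by positivity)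
  have e1 : ((Real.sqrt (L ^ 2 / L ^ d) * L) ^ j) ^ 2 = (L ^ 2 / L ^ d * L ^ 2) ^ j := by
    rw [← pow_mul, mul_comm j 2, pow_mul, mul_pow, eρ]
  have e2 : (L ^ (j + 1)) ^ d = (L ^ d) ^ j * L ^ d := by ring
  rw [e1, e2, mul_pow, div_pow]
  field_simp
  ring

/-- `M^d·((L∕L^d)·L)^j = L^d·(L²)^j` for `M = L^{j+1}` (`L > 0`). [folklore] -/
theorem pow_tower_l1 {L : ℝ} (hL : 0 < L) (d j : ℕ) :
    (L ^ (j + 1)) ^ d * (L / L ^ d * L) ^ j = L ^ d * (L ^ 2) ^ j := by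
  have hLd : 0 < L ^ d := pow_pos hL d
  have e2 : (L ^ (j + 1)) ^ d = (L ^ d) ^ j * L ^ d := by ring
  rw [e2, mul_pow, div_pow]
  field_simp
  ring

/-! ## §2 The two coarse sizes -/

/-- **THE TWO SUMMED COARSE SIZES OF THE NORMAL DATUM FROM THE REMAINDER TOWERS** (hypotheses of `RemainderL1FinalB8.dirL1_QbarIter_le_quadratic`, letters `P`, `Q` under the
displayed k-free lines `(32K)²·L^d ≤ P²·L⁴`, `64K₁′·L^d ≤ Q·L²`): with `M = L^{j+1}`, `φ = QbarIter L (j+1) W Z`, `F = periodBox (N·M)`,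
**`M^d·dirSq φ (periodBox N) ≤ P²·b²·M⁴·dirSq Z F` and `M^d·dirL1 φ (periodBox N) ≤ Q·M²·dirSq Z F`** — the inputs `hφ2`, `hφ1` of
`SupplierB8LevelSizes.decomposedRepT_slicB8_of_landauRepB8Avg_sizes` (with `b = s₁ξ`), WITHOUT any regularity of `Z`. [folklore] -/
theorem coarseSizes_of_towers [Nonempty n] {L N : ℕ} (hL : 2 ≤ L) (hN : 1 ≤ N) (j : ℕ)
    {W : Site d → Fin d → (Matrix n n ℂ)ˣ} {x : ℝ} (hWu : IsUnitaryCfg W) (hWP : IsPeriodicCfg W ((N * L ^ (j + 1) : ℕ) : ℤ))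
    (hx : 0 ≤ x) (hsm : LevelSmall d L j x) (hWx : SmallField W x)
    {α₀ b : ℝ} (hα : 0 < α₀) (hα3 : C0 d * (2 * α₀) ≤ 1 / 3) (hα4 : 4 * (2 * α₀) ≤ c2' d L)
    (h52 : pdev W < α₀ * (((L : ℝ) ^ (j + 1))⁻¹) ^ 2) (hb : 0 ≤ b)
    {Z : Site d → Fin d → Matrix n n ℂ} (hZ : ∀ (y : Site d) (κ : Fin d), ‖Z y κ‖ ≤ b) (hZP : IsPeriodicDir Z ((N * L ^ (j + 1) : ℕ) : ℤ))
    (hsmall : Real.exp (4 * (800 * ((d : ℝ) + 1) ^ 2 * ((d : ℝ) + 4)) * α₀)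
      * (1 + 8 * (131072 * ((d : ℝ) + 1) ^ 2) * ((L : ℝ) ^ (j + 1) * b)) ≤ 2)
    (hc₃ : 4 * ((L : ℝ) ^ (j + 1) * b) ≤ c3 d L)
    (hK : 16 * (C1cov d * (L : ℝ) ^ 2 * Real.sqrt (d * (2 * (2 * L) + 1) ^ d)) * (L : ℝ) ^ (j + 1) * b ≤ Real.sqrt ((L : ℝ) ^ 2 / (L : ℝ) ^ d))
    (hS1 : (16 * (d + 1) * (d + 4) * (L : ℝ) ^ 2 * Csup d L * (d * (2 * nbRad d L + 1) ^ d)) * radSum d L j x ≤ ((L : ℝ) / (L : ℝ) ^ d) / 2)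
    (hdbar : dbavgCovIter L W (expCfg (adField W Z)) (j + 1) = 1)
    {P Q : ℝ}
    (hPl : (32 * (C1cov d * (L : ℝ) ^ 2 * Real.sqrt (d * (2 * (2 * L) + 1) ^ d))) ^ 2 * (L : ℝ) ^ d ≤ P ^ 2 * (L : ℝ) ^ 4)
    (hQl : 64 * (C1cov d * (L : ℝ) ^ 2 * (d * (2 * (2 * (L : ℝ)) + 1) ^ d)) * (L : ℝ) ^ d ≤ Q * (L : ℝ) ^ 2) :
    ((L : ℝ) ^ (j + 1)) ^ d * dirSq (QbarIter L (j + 1) W Z) (periodBox (d := d) N)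
        ≤ P ^ 2 * b ^ 2 * ((L : ℝ) ^ (j + 1)) ^ 4 * dirSq Z (periodBox (d := d) (N * L ^ (j + 1))) ∧
      ((L : ℝ) ^ (j + 1)) ^ d * dirL1 (QbarIter L (j + 1) W Z) (periodBox (d := d) N)
        ≤ Q * ((L : ℝ) ^ (j + 1)) ^ 2 * dirSq Z (periodBox (d := d) (N * L ^ (j + 1))) := by
  have hL0 : (0 : ℝ) < L := by exact_mod_cast (show 0 < L by omega)
  set M : ℝ := (L : ℝ) ^ (j + 1) with hM
  set K : ℝ := C1cov d * (L : ℝ) ^ 2 * Real.sqrt (d * (2 * (2 * L) + 1) ^ d) with hKdef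
  set K1 : ℝ := C1cov d * (L : ℝ) ^ 2 * (d * (2 * (2 * (L : ℝ)) + 1) ^ d) with hK1def
  set ρ : ℝ := Real.sqrt ((L : ℝ) ^ 2 / (L : ℝ) ^ d) with hρdef
  set T : ℝ := dirSq Z (periodBox (d := d) (N * L ^ (j + 1))) with hT
  have hT0 : 0 ≤ T := by rw [hT]; exact l2sq_nonneg _ _
  have hTl : l2sq (periodBox (d := d) (N * L ^ (j + 1))) Z = T := rfl
  have hMd : 0 < M ^ d := by rw [hM]; positivity
  constructor
  · -- the ℓ² tower, squared, times `M^d`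
    have h2 := sqrt_l2sq_QbarIter_le hL hN j hWu hWP hx hsm hWx hα hα3 hα4 h52 hb hZ hZP hsmall hc₃ hK hdbar
    rw [Nat.add_sub_cancel, hTl] at h2
    set X : ℝ := l2sq (periodBox (d := d) N) (QbarIter L (j + 1) W Z) with hX
    have hX0 : 0 ≤ X := l2sq_nonneg _ _
    have hXd : dirSq (QbarIter L (j + 1) W Z) (periodBox (d := d) N) = X := rfl
    set A : ℝ := 32 * K * Real.sqrt T * b * (ρ * L) ^ j with hA
    have hA0 : 0 ≤ A := by
      rw [hA]; have := C1cov_pos d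
      exact mul_nonneg (mul_nonneg (mul_nonneg (mul_nonneg (by norm_num) (by rw [hKdef]; positivity)) (Real.sqrt_nonneg _)) hb)
        (pow_nonneg (mul_nonneg (Real.sqrt_nonneg _) hL0.le) _)
    have hXA : X ≤ A ^ 2 := by
      have h := pow_le_pow_left₀ (Real.sqrt_nonneg X) h2 2
      rw [Real.sq_sqrt hX0] at h
      exact h
    have hA2 : A ^ 2 = (32 * K) ^ 2 * b ^ 2 * ((ρ * L) ^ j) ^ 2 * T := by
      rw [hA]; simp only [mul_pow, Real.sq_sqrt hT0]; ring
    have hpow := pow_tower_l2 hL0 d j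
    rw [← hρdef, ← hM] at hpow
    have hL4j : 0 ≤ ((L : ℝ) ^ 4) ^ j := by positivity
    have hkey : M ^ d * ((32 * K) ^ 2 * b ^ 2 * ((ρ * L) ^ j) ^ 2 * T) ≤ P ^ 2 * b ^ 2 * M ^ 4 * T := by
      have e1 : M ^ d * ((32 * K) ^ 2 * b ^ 2 * ((ρ * L) ^ j) ^ 2 * T) = ((32 * K) ^ 2 * (L : ℝ) ^ d) * ((L : ℝ) ^ 4) ^ j * (b ^ 2 * T) := by
        have : M ^ d * ((ρ * L) ^ j) ^ 2 = (L : ℝ) ^ d * ((L : ℝ) ^ 4) ^ j := hpow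
        calc M ^ d * ((32 * K) ^ 2 * b ^ 2 * ((ρ * L) ^ j) ^ 2 * T)
            = (M ^ d * ((ρ * L) ^ j) ^ 2) * ((32 * K) ^ 2 * (b ^ 2 * T)) := by ring
          _ = ((L : ℝ) ^ d * ((L : ℝ) ^ 4) ^ j) * ((32 * K) ^ 2 * (b ^ 2 * T)) := by rw [this]
          _ = ((32 * K) ^ 2 * (L : ℝ) ^ d) * ((L : ℝ) ^ 4) ^ j * (b ^ 2 * T) := by ring
      have e2 : P ^ 2 * b ^ 2 * M ^ 4 * T = (P ^ 2 * (L : ℝ) ^ 4) * ((L : ℝ) ^ 4) ^ j * (b ^ 2 * T) := by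
        rw [hM, ← pow_mul, ← pow_mul, show (j + 1) * 4 = 4 + 4 * j by ring, pow_add, pow_mul]; ring
      rw [e1, e2]
      exact mul_le_mul_of_nonneg_right (mul_le_mul_of_nonneg_right hPl hL4j) (mul_nonneg (sq_nonneg b) hT0)
    rw [hXd]
    calc M ^ d * X ≤ M ^ d * A ^ 2 := mul_le_mul_of_nonneg_left hXA hMd.le
      _ = M ^ d * ((32 * K) ^ 2 * b ^ 2 * ((ρ * L) ^ j) ^ 2 * T) := by rw [hA2]
      _ ≤ P ^ 2 * b ^ 2 * M ^ 4 * T := hkey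
  · -- the quadratic ℓ¹ tower times `M^d`
    have h1 := dirL1_QbarIter_le_quadratic hL hN j hWu hWP hx hsm hWx hα hα3 hα4 h52 hb hZ hZP hsmall hc₃ hK hS1 hdbar
    rw [Nat.add_sub_cancel, hTl] at h1
    have hpow := pow_tower_l1 hL0 d j
    rw [← hM] at hpow
    have hL2j : 0 ≤ ((L : ℝ) ^ 2) ^ j := by positivity
    have hkey : M ^ d * (64 * K1 * (((L : ℝ) / (L : ℝ) ^ d) * L) ^ j * T) ≤ Q * M ^ 2 * T := by
      have e1 : M ^ d * (64 * K1 * (((L : ℝ) / (L : ℝ) ^ d) * L) ^ j * T) = (64 * K1 * (L : ℝ) ^ d) * ((L : ℝ) ^ 2) ^ j * T := by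
        calc M ^ d * (64 * K1 * (((L : ℝ) / (L : ℝ) ^ d) * L) ^ j * T)
            = (M ^ d * (((L : ℝ) / (L : ℝ) ^ d) * L) ^ j) * (64 * K1 * T) := by ring
          _ = ((L : ℝ) ^ d * ((L : ℝ) ^ 2) ^ j) * (64 * K1 * T) := by rw [hpow]
          _ = (64 * K1 * (L : ℝ) ^ d) * ((L : ℝ) ^ 2) ^ j * T := by ring
      have e2 : Q * M ^ 2 * T = (Q * (L : ℝ) ^ 2) * ((L : ℝ) ^ 2) ^ j * T := by
        rw [hM, ← pow_mul, ← pow_mul, show (j + 1) * 2 = 2 + 2 * j by ring, pow_add, pow_mul]; ring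
      rw [e1, e2]
      exact mul_le_mul_of_nonneg_right (mul_le_mul_of_nonneg_right hQl hL2j) hT0
    calc M ^ d * dirL1 (QbarIter L (j + 1) W Z) (periodBox (d := d) N)
        ≤ M ^ d * (64 * K1 * (((L : ℝ) / (L : ℝ) ^ d) * L) ^ j * T) := mul_le_mul_of_nonneg_left h1 hMd.le
      _ ≤ Q * M ^ 2 * T := hkey

end

end Summit.QuantumFields.BalabanUV.T4Continuum.NE3.CoarseSizesFromTowersB8
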